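import Summits.Ventures.WeilGRH.TwistedTwoPrimeCertOddSound
import Summits.Ventures.WeilGRH.TwistedTwoPrimeDirichlet
import HarnessLib

/-!
# Moment-method certificates for TWISTED Weil weights, XIV: odd characters — from a checked odd TWO-PRIME certificate to the rung of `L(s, χ)`

Cell `rh-explicit`, WEIL TRACK — GRH ARM (namespace `Summit.Ventures.WeilGRH`).  The two-prime analogue of
`TwistedMomentDirichletOdd.lean`: for an ODD character `χ` mod `q ≠ 1` with real `χ(2) = s₂`, `χ(3) = s₃ ∈ {−1, 0, 1}`
the weight of `E_{χ,3}` splits as `M_{χ,3}(τ) = (log q − log π) + twistWeight23 s₂ s₃ τ + π sech(πτ)`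
(`weilFinitePrimeWeightChar_three_sub_eq_of_odd`): the even part is minorised by the signed two-prime cells
(`checkCellsZS23`), the parity bonus is the position-space functional `Re ∫ (g ⋆ g̃)(w) dw/(2cosh(w/2))`
(`bonus_freq_eq_position` of the one-prime file), and `TwistCert23Odd.form_nonneg_of_check` bounds the sum from below.
Results: `weilFinitePrimeQuadraticChar_three_nonneg_of_twistCert23Odd`, **`weilPositivityOnChar_of_twistCert23Odd`**
(`e^{2t} ≤ 4`), `weilPositivityOnChar_of_twistCert23Odd_of_chi_four` (`χ(4) = 0`: `e^{2t} ≤ 5`) — so a kernel evaluation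
of `checkCellsZS23` and `checkAlgOdd` on certificate DATA proves, e.g., the rungs `59/100`, `log 2`, `(log 5)/2` of the odd
character mod `4` (class `4.3`; certificates in EXTREMALS/GRH/twisted-2ripple-CERT).  Everything here is PROVED; no named
facts; nothing about zeros of `L(s, χ)`.
-/

noncomputable section

open Complex Finset MeasureTheory Set Filter
open scoped Real Topology ComplexConjugate BigOperators

namespace Summit.Ventures.WeilGRH

open Literature.NumberTheory.LFunctions Literature.NumberTheory.LFunctions.WeilArchParity
open Literature.Analysis.ValidatedNumerics.Numerics
open Literature.Analysis.SpecialFunctions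

variable {q : ℕ}

/-- For an odd character the two-prime weight minus its level is the twisted even model weight plus the parity bonus:
`M_{χ,3}(τ) − (log q − log π) = twistWeight23 s₂ s₃ τ + π/cosh(πτ)` (`χ(2) = s₂`, `χ(3) = s₃` real). [folklore] -/
theorem weilFinitePrimeWeightChar_three_sub_eq_of_odd (χ : DirichletCharacter ℂ q) {s₂ s₃ : ℤ}
    (hχ2 : χ ((2 : ℕ) : ZMod q) = (s₂ : ℂ)) (hχ3 : χ ((3 : ℕ) : ZMod q) = (s₃ : ℂ)) (hodd : charParity χ = 1) (τ : ℝ) :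
    weilFinitePrimeWeightChar χ 3 τ - (Real.log q - Real.log π) =
      twistWeight23 s₂ s₃ τ + π / Real.cosh (π * τ) := by
  unfold weilFinitePrimeWeightChar twistWeight23 twistWeight reDigammaQuarter
  rw [weilPrimeRippleChar_three_of_chi χ hχ2 hχ3 τ, hodd]
  have h := re_digamma_par_one_sub_zero τ
  have e0 : (1 / 4 + ((0 : ℕ) : ℂ) / 2 + τ / 2 * I : ℂ) = 1 / 4 + (τ : ℂ) / 2 * I := by push_cast; ring
  rw [e0] at h
  linarith

/-- **`E_{χ,3} ≥ 0` on `C(b)` from a checked ODD two-prime certificate.** For an odd `χ` mod `q` with real `χ(2) = s₂`,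
`χ(3) = s₃`, cells accepted by `checkCellsZS23 s₂ s₃ p j`, an odd certificate accepted by `checkAlgOdd`, and
`ellLo ≤ log q − log π`: `0 ≤ E_{χ,3}(g)` for every test function `g` with `tsupport g ⊆ [−b, b]`. [folklore] -/
theorem weilFinitePrimeQuadraticChar_three_nonneg_of_twistCert23Odd (c : TwistCert23Odd) {s₂ s₃ : ℤ} {p j M : ℕ}
    (hcells : checkCellsZS23 s₂ s₃ p j c.cert.frame.wL c.cert.frame.T M c.cert.cells = true)
    (halg : c.checkAlgOdd = true)
    (χ : DirichletCharacter ℂ q) (hχ2 : χ ((2 : ℕ) : ZMod q) = (s₂ : ℂ)) (hχ3 : χ ((3 : ℕ) : ZMod q) = (s₃ : ℂ))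
    (hodd : charParity χ = 1) (hℓ : ((c.cert.ellLo : ℚ) : ℝ) ≤ Real.log q - Real.log π)
    {g : ℝ → ℂ} (hg : IsWeilTest g) (hsupp : tsupport g ⊆ Icc (-(c.cert.b : ℝ)) c.cert.b) :
    0 ≤ weilFinitePrimeQuadraticChar χ 3 g := by
  have hOK := cellsOKW23_of_checkCellsZS23 hcells
  obtain ⟨-, -, hs2, hs3, -, -, -⟩ := checkCellsZS23_spec hcells
  set W : ℝ → ℝ := twistWeight23 s₂ s₃ with hW
  set B : ℝ → ℝ := fun t ↦ π / Real.cosh (π * t) with hB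
  have hWi : Integrable fun t : ℝ ↦ ‖weilMellin g (1 / 2 + t * I)‖ ^ 2 * W t := by
    have h1 := integrable_norm_sq_weilMellin_mul_reDigammaQuarter hg
    have h2 : Integrable fun t : ℝ ↦ ‖weilMellin g (1 / 2 + t * I)‖ ^ 2 *
        ((s₂ : ℝ) * (-(Real.sqrt 2 * Real.log 2 * Real.cos (t * Real.log 2)))) :=
      integrable_norm_sq_weilMellin_mul hg (by fun_prop) (A := |(s₂ : ℝ)| * (Real.sqrt 2 * Real.log 2)) (B := 0)
        (by positivity) le_rfl fun t ↦ by
          rw [zero_mul, add_zero, abs_mul, abs_neg, abs_mul,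
            abs_of_nonneg (by positivity : (0 : ℝ) ≤ Real.sqrt 2 * Real.log 2)]
          exact mul_le_mul_of_nonneg_left (mul_le_of_le_one_right (by positivity) (Real.abs_cos_le_one _))
            (abs_nonneg _)
    have h3 : Integrable fun t : ℝ ↦ ‖weilMellin g (1 / 2 + t * I)‖ ^ 2 *
        ((s₃ : ℝ) * (-(2 * Real.log 3 / Real.sqrt 3 * Real.cos (t * Real.log 3)))) :=
      integrable_norm_sq_weilMellin_mul hg (by fun_prop) (A := |(s₃ : ℝ)| * (2 * Real.log 3 / Real.sqrt 3)) (B := 0)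
        (mul_nonneg (abs_nonneg _) cThree_nonneg) le_rfl fun t ↦ by
          rw [zero_mul, add_zero, abs_mul, abs_neg, abs_mul, abs_of_nonneg cThree_nonneg]
          exact mul_le_mul_of_nonneg_left (mul_le_of_le_one_right cThree_nonneg (Real.abs_cos_le_one _))
            (abs_nonneg _)
    refine ((h1.add h2).add h3).congr (Eventually.of_forall fun t ↦ ?_)
    simp only [Pi.add_apply, hW, twistWeight23, twistWeight]
    ring
  have hBi : Integrable fun t : ℝ ↦ ‖weilMellin g (1 / 2 + t * I)‖ ^ 2 * B t :=
    integrable_norm_sq_weilMellin_mul hg (by fun_prop) (A := π) (B := 0) Real.pi_pos.le le_rfl fun t ↦ by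
      rw [zero_mul, add_zero, hB]
      simp only
      rw [abs_div, abs_of_pos Real.pi_pos, abs_of_pos (Real.cosh_pos _)]
      exact div_le_self Real.pi_pos.le (Real.one_le_cosh _)
  have hmain := TwistCert23Odd.form_nonneg_of_check_mono halg hOK (twistWeight23_neg s₂ s₃) (fun _ ↦ le_rfl) hℓ hg hWi hsupp
  have hsplit : weilFinitePrimeQuadraticChar χ 3 g =
      (Real.log q - Real.log π) * weilNorm2Sq g +
        1 / (2 * π) * (∫ t : ℝ, ‖weilMellin g (1 / 2 + t * I)‖ ^ 2 * W t) +
        1 / (2 * π) * ∫ t : ℝ, ‖weilMellin g (1 / 2 + t * I)‖ ^ 2 * B t := by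
    unfold weilFinitePrimeQuadraticChar
    have h1 := integrable_norm_sq_weilMellin_half_line hg
    have e : (fun τ : ℝ ↦ ‖weilMellin g (1 / 2 + τ * I)‖ ^ 2 * weilFinitePrimeWeightChar χ 3 τ) =
        fun τ : ℝ ↦ (‖weilMellin g (1 / 2 + τ * I)‖ ^ 2 * W τ + ‖weilMellin g (1 / 2 + τ * I)‖ ^ 2 * B τ) +
          (Real.log q - Real.log π) * ‖weilMellin g (1 / 2 + τ * I)‖ ^ 2 := by
      funext τ
      have := weilFinitePrimeWeightChar_three_sub_eq_of_odd χ hχ2 hχ3 hodd τ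
      rw [hW, hB]; simp only
      linear_combination (‖weilMellin g (1 / 2 + τ * I)‖ ^ 2) * this
    have hWB : Integrable fun t : ℝ ↦
        ‖weilMellin g (1 / 2 + t * I)‖ ^ 2 * W t + ‖weilMellin g (1 / 2 + t * I)‖ ^ 2 * B t := hWi.add hBi
    rw [e, integral_add hWB (h1.const_mul _), integral_add hWi hBi, integral_const_mul,
      integral_norm_sq_weilMellin_half_line hg]
    set X := ∫ t : ℝ, ‖weilMellin g (1 / 2 + t * I)‖ ^ 2 * W t
    set Y := ∫ t : ℝ, ‖weilMellin g (1 / 2 + t * I)‖ ^ 2 * B t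
    have hπ : (π : ℝ) ≠ 0 := Real.pi_ne_zero
    field_simp
    ring
  rw [hsplit, hB]
  simp only
  rw [bonus_freq_eq_position hg]
  exact hmain

/-- **The rung from a checked odd two-prime certificate**: `WeilPositivityOnChar χ t` for every `t ≤ b` with
`e^{2t} ≤ 4`, `χ` odd mod `q ≠ 1` with real `χ(2) = s₂`, `χ(3) = s₃`. [folklore] -/
theorem weilPositivityOnChar_of_twistCert23Odd (c : TwistCert23Odd) {s₂ s₃ : ℤ} {p j M : ℕ}
    (hcells : checkCellsZS23 s₂ s₃ p j c.cert.frame.wL c.cert.frame.T M c.cert.cells = true)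
    (halg : c.checkAlgOdd = true) (hq : q ≠ 1) (χ : DirichletCharacter ℂ q)
    (hχ2 : χ ((2 : ℕ) : ZMod q) = (s₂ : ℂ)) (hχ3 : χ ((3 : ℕ) : ZMod q) = (s₃ : ℂ)) (hodd : charParity χ = 1)
    (hℓ : ((c.cert.ellLo : ℚ) : ℝ) ≤ Real.log q - Real.log π)
    {t : ℝ} (htb : t ≤ (c.cert.b : ℝ)) (ht4 : Real.exp (2 * t) ≤ 4) :
    WeilPositivityOnChar χ t := by
  intro g hg hsupp
  have h4 : Real.exp (2 * t) ≤ ((3 : ℕ) : ℝ) + 1 := by norm_num; exact ht4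
  rw [weilQuadraticChar_re_eq_weilFinitePrimeQuadraticChar hq χ hg h4 hsupp]
  exact weilFinitePrimeQuadraticChar_three_nonneg_of_twistCert23Odd c hcells halg χ hχ2 hχ3 hodd hℓ hg
    (hsupp.trans (Icc_subset_Icc (by linarith) htb))

/-- **The rung for an odd character with `χ(4) = 0`** (e.g. the odd character mod `4`): `WeilPositivityOnChar χ t` for
every `t ≤ b` with `e^{2t} ≤ 5`. [folklore] -/
theorem weilPositivityOnChar_of_twistCert23Odd_of_chi_four (c : TwistCert23Odd) {s₂ s₃ : ℤ} {p j M : ℕ}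
    (hcells : checkCellsZS23 s₂ s₃ p j c.cert.frame.wL c.cert.frame.T M c.cert.cells = true)
    (halg : c.checkAlgOdd = true) (hq : q ≠ 1) (χ : DirichletCharacter ℂ q)
    (hχ2 : χ ((2 : ℕ) : ZMod q) = (s₂ : ℂ)) (hχ3 : χ ((3 : ℕ) : ZMod q) = (s₃ : ℂ)) (hχ4 : χ ((4 : ℕ) : ZMod q) = 0)
    (hodd : charParity χ = 1) (hℓ : ((c.cert.ellLo : ℚ) : ℝ) ≤ Real.log q - Real.log π)
    {t : ℝ} (htb : t ≤ (c.cert.b : ℝ)) (ht5 : Real.exp (2 * t) ≤ 5) :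
    WeilPositivityOnChar χ t := by
  intro g hg hsupp
  have h5 : Real.exp (2 * t) ≤ ((4 : ℕ) : ℝ) + 1 := by norm_num; exact ht5
  rw [weilQuadraticChar_re_eq_weilFinitePrimeQuadraticChar hq χ hg h5 hsupp,
    weilFinitePrimeQuadraticChar_four_eq_three_of_chi_four χ hχ4]
  exact weilFinitePrimeQuadraticChar_three_nonneg_of_twistCert23Odd c hcells halg χ hχ2 hχ3 hodd hℓ hg
    (hsupp.trans (Icc_subset_Icc (by linarith) htb))

/-- **The rung at a rational window `t₀ ≤ b` with `e^{2t₀} ≤ 5` for the odd character mod 4** packaged for the three data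
points `59/100`, `log 2` (via `logTwoHi`) and `(log 5)/2` is obtained from the two theorems above by the caller; here the
`(log 5)/2` window test: `e^{2·(log 5/2)} = 5`. [folklore] -/
theorem exp_two_mul_log_five_half : Real.exp (2 * (Real.log 5 / 2)) = 5 := by
  rw [show 2 * (Real.log 5 / 2) = Real.log 5 by ring, Real.exp_log (by norm_num)]

end Summit.Ventures.WeilGRH

end
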